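import Literature.RingTheory.KTheory.MilnorKStiefelWhitneyAugmentationPowers
import Literature.RingTheory.KTheory.MilnorKWittRingSignature
import Literature.RingTheory.KTheory.MilnorKModTwoReal
import HarnessLib

/-!
# The Witt ring of a Euclidean ordered field: `W(F) ≅ ℤ` by the signature, `Iⁿ = 2ⁿℤ`, `⋂ Iⁿ = 0`; and LEMMA 4.6 for
# `F = ℝ`: every `sₙ : kₙℝ → Iⁿ/Iⁿ⁺¹` is bijective (Milnor, *Algebraic K-theory and quadratic forms*, Invent. Math. 9
# (1970), §4)

Family `hodge`, lane `lit-hodgefound` (foundations library; seat `lit-hodgefound-p27`, generation 41, row g41-#5);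
topic `RingTheory/KTheory`.  Sequel of `MilnorKStiefelWhitneyAugmentationPowers` (g41-#4: REMARK 4.2
`sHom_injective_of_mulPow_injective`, `sHom_zero_injective`), g40's `MilnorKWittRingSignature` (`signature`,
`two_pow_dvd_signature`, `signature_eq_zero_of_forall_mem`), `MilnorKModTwoReal` (`k_nℝ = {0, l(−1)ⁿ}`) and
`MilnorKReal` (`nonnegPreordering`).  PROVED THEOREMS and definitions with bodies; no named fact, no instance, no notation,
0 `sorry`, net debt 0 (D-0026).  A validation instance of the lane's Layer-A style: the whole §3–§4 apparatus evaluated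
on the real field.

## The source, verbatim

J. Milnor, *Algebraic K-theory and quadratic forms*, Invent. Math. 9 (1970) 318–344 (held `paper:doi-10-1007-bf01425486`;
bib key `Milnor1970`), §4 (p0016 L5–L8): «first note that each embedding of F in the real field gives rise to a ring
homomorphism WF → Wℝ ≅ Z called the signature.»  (p0016 L19–L20): «But each such signature carries the ideal IF to 2Z,
and hence carries the intersection of the ideals IⁿF to ∩ 2ⁿZ = 0.»  (p0016 L21–L24, L31–L38): «LEMMA 4.6. Now suppose
that F is a field such that k₂F has at most two distinct elements. Then again the s_n are bijective and ∩ Iⁿ = 0.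
Notice that this includes the case of a finite, or local, or real closed, or quadratically closed field […] On the
other hand if k₁ modulo this null-space has dimension 1, then it is easy to define the "signature" of a quadratic
module, and to show that the rank, discriminant, and signature form a complete invariant. […] Since the signature of
an element in Iⁿ is divisible by 2ⁿ, it follows that ∩ Iⁿ = 0. Futhermore, techniques similar to those of §1.4 show
that k_n is cyclic of order 2, generated by l(−1)ⁿ, for every n > 2; hence §4.2 implies that every s_n is bijective.»

## What is formalised

* For an ordered field `F` in which positive elements are squares (Euclidean; e.g. `ℝ`, real closed fields), on the
  presented Witt ring of `MilnorKWittRing`: `gen_eq_one_of_pos : (a) = 1` (`a > 0`), `gen_eq_neg_one_of_neg : (a) = −1`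
  (`a < 0`), `exists_intCast_eq` (every element is an integer), **`signatureEquiv : W(F) ≃+* ℤ`** («Wℝ ≅ Z», the
  signature of g40's `MilnorKWittRingSignature` at the positive cone; «rank, discriminant, and signature form a complete
  invariant»), **`mem_pow_fundIdeal_iff_dvd : w ∈ Iⁿ ↔ 2ⁿ ∣ signature w`** («carries the ideal IF to 2Z»),
  **`iInf_pow_fundIdeal_eq_bot : ⋂ Iⁿ = 0`**.
* For `F = ℝ`: `real_isSquare_of_pos`; **LEMMA 4.6: `mulPow_real_injective`** («k_n is cyclic of order 2, generated by
  l(−1)ⁿ» — g40's `eq_zero_or_eq_kSymbol_neg_one` — so multiplication by `l(−1)^{t−n}` is injective),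
  **`sHom_real_injective : every sₙ : kₙℝ → Iⁿ/Iⁿ⁺¹ is injective`** («hence §4.2 implies that every s_n is
  bijective», by g41-#4's REMARK 4.2), **`existsUnique_sHom_real_eq`** (bijective, with g40's surjectivity),
  `wittRingRealEquiv : W(ℝ) ≃+* ℤ`, `iInf_pow_fundIdeal_real_eq_bot`.
* Not here: the finite / local / quadratically closed cases of Lemma 4.6 (Kaplansky–Shaker), Lemma 4.5.

## References

* [Milnor1970] J. Milnor, *Algebraic K-theory and quadratic forms*, Invent. Math. 9 (1970) 318–344 — §4, the signature
  (p0016 L5–L8, L19–L20), Lemma 4.6 and its proof (p0016 L21–L38); Remark 4.2 (p0015 L25–L27).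

Provenance: lane `lit-hodgefound`, seat `lit-hodgefound-p27` gen 41 (agent `literature-prover-lit-hodgefound-p27-g41-0`),
row g41-#5.
-/

set_option autoImplicit false

noncomputable section

namespace Literature.RingTheory.KTheory

open Function

namespace WittRing

/-! ### Euclidean ordered fields: `W(F) ≅ ℤ` -/

section Euclidean

variable (F : Type*) [Field F] [LinearOrder F] [IsStrictOrderedRing F]

omit [IsStrictOrderedRing F] in
/-- **`(a) = 1` for `a > 0`** when positive elements are squares. [cite: Milnor1970, §4 proof of Lemma 4.6 «the rank, discriminant, and signature form a complete invariant» (p0016 L31–L34)] -/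
theorem gen_eq_one_of_pos (hE : ∀ a : F, 0 < a → IsSquare a) {a : Fˣ} (ha : 0 < (a : F)) : gen F a = 1 := by
  obtain ⟨b, hb⟩ := hE a ha
  have hb0 : b ≠ 0 := by rintro rfl; rw [mul_zero] at hb; exact a.ne_zero hb
  exact gen_eq_one_of_isSquare F ⟨Units.mk0 b hb0, Units.ext (by rw [Units.val_mul, Units.val_mk0]; exact hb)⟩

/-- **`(a) = −1` for `a < 0`** when positive elements are squares (`(a) + (−a) = 0` and `(−a) = 1`). [cite: Milnor1970, §4 proof of Lemma 4.6 (p0016 L31–L34)] -/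
theorem gen_eq_neg_one_of_neg (hE : ∀ a : F, 0 < a → IsSquare a) {a : Fˣ} (ha : (a : F) < 0) : gen F a = -1 := by
  have h : gen F (-a) = 1 := gen_eq_one_of_pos F hE (by rw [Units.val_neg]; exact neg_pos.2 ha)
  have h2 := gen_add_gen_neg F a
  rw [h] at h2
  linear_combination h2

/-- Every element of `W(F)` is an integer (`F` Euclidean). [cite: Milnor1970, §4 «Wℝ ≅ Z» (p0016 L7)] -/
theorem exists_intCast_eq (hE : ∀ a : F, 0 < a → IsSquare a) (w : WittRing F) : ∃ n : ℤ, w = n := by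
  obtain ⟨x, rfl⟩ := mk_surjective F w
  induction x using FreeCommRing.induction_on with
  | neg_one => exact ⟨-1, by rw [map_neg, map_one, Int.cast_neg, Int.cast_one]⟩
  | of a =>
    change ∃ n : ℤ, gen F a = n
    rcases lt_or_gt_of_ne (a.ne_zero) with ha | ha
    · exact ⟨-1, by rw [gen_eq_neg_one_of_neg F hE ha, Int.cast_neg, Int.cast_one]⟩
    · exact ⟨1, by rw [gen_eq_one_of_pos F hE ha, Int.cast_one]⟩
  | add x y hx hy =>
    obtain ⟨m, hm⟩ := hx
    obtain ⟨n, hn⟩ := hy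
    exact ⟨m + n, by rw [map_add, hm, hn, Int.cast_add]⟩
  | mul x y hx hy =>
    obtain ⟨m, hm⟩ := hx
    obtain ⟨n, hn⟩ := hy
    exact ⟨m * n, by rw [map_mul, hm, hn, Int.cast_mul]⟩

/-- **The signature of an ordered field** `W(F) → ℤ` at its positive cone (g40's `signature`). [cite: Milnor1970, §4 «a ring homomorphism WF → Wℝ ≅ Z called the signature» (p0016 L5–L8)] -/
def signatureOrd : WittRing F →+* ℤ := signature F (nonnegPreordering F) nonnegPreordering_total

/-- `signatureOrd` unfolded. [cite: Milnor1970, §4 (p0016 L5–L8)] -/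
theorem signatureOrd_def : signatureOrd F = signature F (nonnegPreordering F) nonnegPreordering_total := rfl

/-- `signatureOrd (a) = 1` for `a > 0`. [cite: Milnor1970, §4 (p0016 L5–L8)] -/
theorem signatureOrd_gen_of_pos {a : Fˣ} (ha : 0 < (a : F)) : signatureOrd F (gen F a) = 1 :=
  signature_gen_of_mem nonnegPreordering_total ((mem_nonnegPreordering_iff _).2 ha.le)

/-- `signatureOrd (a) = −1` for `a < 0`. [cite: Milnor1970, §4 (p0016 L5–L8)] -/
theorem signatureOrd_gen_of_neg {a : Fˣ} (ha : (a : F) < 0) : signatureOrd F (gen F a) = -1 :=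
  signature_gen_of_not_mem nonnegPreordering_total (fun h => not_le.2 ha ((mem_nonnegPreordering_iff _).1 h))

/-- The signature of an integer is itself. [cite: Milnor1970, §4 (p0016 L5–L8)] -/
theorem signatureOrd_intCast (n : ℤ) : signatureOrd F (n : WittRing F) = n := map_intCast _ n

/-- For `F` Euclidean the signature recovers the element: `(signature w : W(F)) = w`. [cite: Milnor1970, §4 «Wℝ ≅ Z» (p0016 L7); proof of Lemma 4.6 «the rank, discriminant, and signature form a complete invariant» (p0016 L31–L34)] -/
theorem intCast_signatureOrd (hE : ∀ a : F, 0 < a → IsSquare a) (w : WittRing F) : ((signatureOrd F w : ℤ) : WittRing F) = w := by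
  obtain ⟨n, rfl⟩ := exists_intCast_eq F hE w
  rw [signatureOrd_intCast]

/-- The signature of a Euclidean ordered field is bijective. [cite: Milnor1970, §4 «Wℝ ≅ Z» (p0016 L7)] -/
theorem signatureOrd_bijective (hE : ∀ a : F, 0 < a → IsSquare a) : Function.Bijective (signatureOrd F) :=
  ⟨fun x y h => by rw [← intCast_signatureOrd F hE x, ← intCast_signatureOrd F hE y, h], fun n => ⟨n, signatureOrd_intCast F n⟩⟩

/-- **`W(F) ≅ ℤ` by the signature** for a Euclidean ordered field («Wℝ ≅ Z»). [cite: Milnor1970, §4 (p0016 L5–L8)] -/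
def signatureEquiv (hE : ∀ a : F, 0 < a → IsSquare a) : WittRing F ≃+* ℤ :=
  RingEquiv.ofBijective (signatureOrd F) (signatureOrd_bijective F hE)

/-- `signatureEquiv` is the signature. [cite: Milnor1970, §4 (p0016 L5–L8)] -/
theorem signatureEquiv_apply (hE : ∀ a : F, 0 < a → IsSquare a) (w : WittRing F) : signatureEquiv F hE w = signatureOrd F w := rfl

/-- **`Iⁿ = 2ⁿW`: `w ∈ Iⁿ ↔ 2ⁿ ∣ signature w`** for a Euclidean ordered field («each such signature carries the ideal IF
to 2Z»; conversely `2 ∈ I`). [cite: Milnor1970, §4 (p0016 L19–L20); proof of Lemma 4.6 «the signature of an element in Iⁿ is divisible by 2ⁿ» (p0016 L34–L35)] -/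
theorem mem_pow_fundIdeal_iff_dvd (hE : ∀ a : F, 0 < a → IsSquare a) (n : ℕ) (w : WittRing F) :
    w ∈ fundIdeal F ^ n ↔ (2 : ℤ) ^ n ∣ signatureOrd F w := by
  refine ⟨fun h => two_pow_dvd_signature _ nonnegPreordering_total h, fun ⟨m, hm⟩ => ?_⟩
  rw [← intCast_signatureOrd F hE w, hm, Int.cast_mul, Int.cast_pow, Int.cast_ofNat]
  exact Ideal.mul_mem_right _ _ (Ideal.pow_mem_pow (two_mem_fundIdeal F) n)

/-- **`⋂ₙ Iⁿ = 0`** for a Euclidean ordered field («carries the intersection of the ideals IⁿF to ∩ 2ⁿZ = 0»; LEMMA 4.6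
«∩ Iⁿ = 0»). [cite: Milnor1970, §4 (p0016 L19–L20); Lemma 4.6 (p0016 L21–L22, L34–L35)] -/
theorem iInf_pow_fundIdeal_eq_bot (hE : ∀ a : F, 0 < a → IsSquare a) : (⨅ n : ℕ, fundIdeal F ^ n) = ⊥ := by
  rw [eq_bot_iff]
  intro w hw
  rw [Ideal.mem_bot, ← intCast_signatureOrd F hE w, signatureOrd_def,
    signature_eq_zero_of_forall_mem _ nonnegPreordering_total fun n => (Ideal.mem_iInf.1 hw) n, Int.cast_zero]

end Euclidean

/-! ### `F = ℝ`: LEMMA 4.6 -/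

section Real

open MilnorKStar

/-- Positive reals are squares. [cite: Milnor1970, §4 Lemma 4.6 «real closed» (p0016 L23)] -/
theorem real_isSquare_of_pos : ∀ a : ℝ, 0 < a → IsSquare a := fun a ha => ⟨Real.sqrt a, (Real.mul_self_sqrt ha.le).symm⟩

/-- **`W(ℝ) ≅ ℤ`** («Wℝ ≅ Z»). [cite: Milnor1970, §4 (p0016 L7)] -/
def wittRingRealEquiv : WittRing ℝ ≃+* ℤ := signatureEquiv ℝ real_isSquare_of_pos

/-- `wittRingRealEquiv (a) = 1` for `a > 0`. [cite: Milnor1970, §4 (p0016 L7)] -/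
theorem wittRingRealEquiv_gen_of_pos {a : ℝˣ} (ha : 0 < (a : ℝ)) : wittRingRealEquiv (gen ℝ a) = 1 := signatureOrd_gen_of_pos ℝ ha

/-- `wittRingRealEquiv (a) = −1` for `a < 0`. [cite: Milnor1970, §4 (p0016 L7)] -/
theorem wittRingRealEquiv_gen_of_neg {a : ℝˣ} (ha : (a : ℝ) < 0) : wittRingRealEquiv (gen ℝ a) = -1 := signatureOrd_gen_of_neg ℝ ha

/-- **`⋂ₙ Iⁿℝ = 0`** (LEMMA 4.6 for `ℝ`). [cite: Milnor1970, §4 Lemma 4.6 «∩ Iⁿ = 0 […] real closed» (p0016 L21–L24)] -/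
theorem iInf_pow_fundIdeal_real_eq_bot : (⨅ n : ℕ, fundIdeal ℝ ^ n) = ⊥ := iInf_pow_fundIdeal_eq_bot ℝ real_isSquare_of_pos

/-- `l(−1)⋯l(−1)` (`m` factors) in `KC`: `kOfDegC {−1, …, −1} = l(−1)^m`. [cite: Milnor1970, §4 proof of Lemma 4.6 «k_n is cyclic of order 2, generated by l(−1)ⁿ» (p0016 L35–L36)] -/
theorem kOfDegC_kSymbol_neg_one (m : ℕ) :
    kOfDegC ℝ m (MilnorK.kSymbol fun _ : Fin m => (-1 : ℝˣ)) = klc ℝ (-1) ^ m := by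
  rw [kOfDegC_kSymbol, List.ofFn_const, List.prod_replicate]

/-- `l(−1)^m ≠ 0` in `k_*ℝ`. [cite: Milnor1970, §1 Example 1.6 «l(−1)ⁿ is not divisible» (p0004 L16–L17); §4 proof of Lemma 4.6 (p0016 L35–L36)] -/
theorem klc_neg_one_pow_ne_zero (m : ℕ) : klc ℝ (-1) ^ m ≠ 0 := by
  rw [← kOfDegC_kSymbol_neg_one, Ne, ← (kOfDegC ℝ m).map_zero, (kOfDegC_injective ℝ m).eq_iff]
  exact MilnorK.kSymbol_neg_one_ne_zero

/-- **LEMMA 4.6 for `ℝ`, the hypothesis of REMARK 4.2: multiplication by `l(−1)^{t−n}` is injective on `kₙℝ`**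
(`kₙℝ = {0, l(−1)ⁿ}` and `l(−1)^t ≠ 0`). [cite: Milnor1970, §4 proof of Lemma 4.6 «k_n is cyclic of order 2, generated by l(−1)ⁿ […] hence §4.2 implies that every s_n is bijective» (p0016 L35–L38)] -/
theorem mulPow_real_injective (n : ℕ) : Function.Injective (mulPow ℝ n) := by
  refine (injective_iff_map_eq_zero _).2 fun x hx => ?_
  rcases MilnorK.eq_zero_or_eq_kSymbol_neg_one n x with rfl | rfl
  · rfl
  · exfalso
    have hle : n + 1 ≤ 2 ^ n := Nat.lt_two_pow_self
    rw [mulPow_apply, kOfDegC_kSymbol_neg_one, ← pow_add, Nat.add_sub_cancel' hle] at hx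
    exact klc_neg_one_pow_ne_zero (2 ^ n) hx

/-- **LEMMA 4.6 for `ℝ`: every `sₙ : kₙℝ → Iⁿℝ/Iⁿ⁺¹ℝ` is injective** (`n ≥ 1` by REMARK 4.2, `n = 0` by `s₀ : k₀ ≅ W/I`).
[cite: Milnor1970, §4 Lemma 4.6 «Then again the s_n are bijective […] real closed» (p0016 L21–L24) and its proof (p0016 L35–L38)] -/
theorem sHom_real_injective (n : ℕ) : Function.Injective (sHom ℝ n) := by
  cases n with
  | zero => exact sHom_zero_injective ℝ
  | succ n => exact sHom_injective_of_mulPow_injective ℝ two_ne_zero (mulPow_real_injective n)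

/-- **LEMMA 4.6 for `ℝ`: the `sₙ : kₙℝ ≅ Iⁿℝ/Iⁿ⁺¹ℝ` are bijective** — every class has exactly one preimage (with g40's
surjectivity `exists_sHom_eq`). [cite: Milnor1970, §4 Lemma 4.6 «Then again the s_n are bijective» (p0016 L21–L24)] -/
theorem existsUnique_sHom_real_eq (n : ℕ) (y : WittRing ℝ) (hy : y ∈ fundIdeal ℝ ^ n) :
    ∃! x : MilnorK.Mod2 ℝ n, sHom ℝ n x = grMk ℝ n y hy := by
  obtain ⟨x, hx⟩ := exists_sHom_eq ℝ y hy
  exact ⟨x, hx, fun x' hx' => sHom_real_injective n (hx'.trans hx.symm)⟩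

/-- `Iⁿℝ/Iⁿ⁺¹ℝ` is nonzero: `2ⁿ ∈ Iⁿ ∖ Iⁿ⁺¹` (so `sₙ(l(−1)ⁿ) ≠ 0`, consistent with `kₙℝ = ℤ/2`). [cite: Milnor1970, §4 Lemma 4.6 (p0016 L21–L24); «carries the ideal IF to 2Z» (p0016 L19)] -/
theorem two_pow_mem_and_not_mem (n : ℕ) :
    (2 : WittRing ℝ) ^ n ∈ fundIdeal ℝ ^ n ∧ (2 : WittRing ℝ) ^ n ∉ fundIdeal ℝ ^ (n + 1) := by
  refine ⟨Ideal.pow_mem_pow (two_mem_fundIdeal ℝ) n, fun h => ?_⟩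
  rw [mem_pow_fundIdeal_iff_dvd ℝ real_isSquare_of_pos, map_pow, map_ofNat] at h
  have h1 : (2 : ℤ) ^ (n + 1) ≤ 2 ^ n := Int.le_of_dvd (pow_pos two_pos n) h
  have h2 : (2 : ℤ) ^ n < 2 ^ (n + 1) := pow_lt_pow_right₀ one_lt_two (Nat.lt_succ_self n)
  exact absurd h1 (not_le.2 h2)

end Real

end WittRing

end Literature.RingTheory.KTheory

end
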